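import Mathlib.RepresentationTheory.Maschke
import Mathlib.RingTheory.Jacobson.Semiprimary
import Mathlib.RingTheory.Ideal.Quotient.Operations
import Mathlib.Data.ZMod.Basic
import Mathlib.FieldTheory.Finite.Basic
import HarnessLib

/-!
# The group ring `ℤ[Γ]/(q) = 𝔽_q[Γ]` is reduced for `q ∤ #Γ` [Schoof2009, Chapter 13]

[Schoof2009, Chapter 13] ("Semisimple group rings"): for a finite abelian group `Γ` and a field `k`
of characteristic not dividing `#Γ` the group ring `k[Γ]` is semisimple, a finite product of
fields ([Schoof2009, p. 85]). This first file of the formalisation of [Schoof2009, Propositions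
13.1, 13.2] records the base change `ℤ[Γ] → 𝔽_q[Γ]`, needed to pass from `ℤ[Γ]`-modules
(class groups, unit groups) to `𝔽_q[Γ]`-modules:

* `Catalan.Semisimple.mapRingHom_intCast_surjective`, `ker_mapRingHom_intCast` — the reduction
  map `ℤ[Γ] → (ℤ/q)[Γ]` is onto with kernel `(q)`;
* `Catalan.Semisimple.isReduced_quotient_span` — **`ℤ[Γ]/(q) ≅ 𝔽_q[Γ]` is reduced** when the
  prime `q` does not divide `#Γ` (Maschke: `𝔽_q[Γ]` is semisimple, and a commutative semisimple
  ring is reduced) [Schoof2009, p. 85, Proposition 13.1].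

Everything is proved; no definitions.

## References

* R. Schoof, *Catalan's Conjecture*, Universitext, Springer 2009 [Schoof2009], Chapter 13
  (pp. 85–86, Proposition 13.1) — held, `lit read book:schoof2009-catalan-s-conjecture`
  (PDF pp. 163–164).
-/

namespace Literature.NumberTheory.DiophantineGeometry

namespace Catalan.Semisimple

open MonoidAlgebra

variable {Γ : Type*} [CommGroup Γ]

/-- The reduction map `ℤ[Γ] → (ℤ/q)[Γ]` is surjective. [folklore] -/
theorem mapRingHom_intCast_surjective (q : ℕ) :
    Function.Surjective (mapRingHom Γ (Int.castRingHom (ZMod q))) := by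
  intro y
  refine ⟨ofCoeff (y.coeff.mapRange (fun a => ((a.cast : ℤ))) (by simp)), ?_⟩
  apply MonoidAlgebra.ext
  ext g
  rw [coeff_mapRingHom, coeff_ofCoeff, Finsupp.mapRange_apply, eq_intCast, ZMod.intCast_zmod_cast]

/-- The kernel of `ℤ[Γ] → (ℤ/q)[Γ]` is the principal ideal `(q)`. [folklore] -/
theorem ker_mapRingHom_intCast (q : ℕ) :
    RingHom.ker (mapRingHom Γ (Int.castRingHom (ZMod q))) =
      Ideal.span {(q : MonoidAlgebra ℤ Γ)} := by
  apply le_antisymm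
  · intro x hx
    rw [RingHom.mem_ker] at hx
    -- every coefficient is divisible by `q`
    have hdvd : ∀ g, (q : ℤ) ∣ x.coeff g := fun g => by
      have := congrArg (fun z : MonoidAlgebra (ZMod q) Γ => z.coeff g) hx
      simp only [coeff_mapRingHom, eq_intCast, MonoidAlgebra.coeff_zero, Finsupp.coe_zero,
        Pi.zero_apply] at this
      exact (ZMod.intCast_zmod_eq_zero_iff_dvd _ _).mp this
    rw [Ideal.mem_span_singleton']
    refine ⟨ofCoeff (x.coeff.mapRange (fun a => a / q) (by simp)), ?_⟩
    apply MonoidAlgebra.ext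
    ext g
    rw [mul_comm, natCast_def, coeff_single_one_mul, coeff_ofCoeff, Finsupp.mapRange_apply]
    exact Int.mul_ediv_cancel' (hdvd g)
  · rw [Ideal.span_le, Set.singleton_subset_iff, SetLike.mem_coe, RingHom.mem_ker, map_natCast,
      natCast_def, ZMod.natCast_self, single_zero]

omit [CommGroup Γ] in
/-- `q ∤ #Γ` makes `#Γ` invertible in `𝔽_q` (the hypothesis of Maschke's theorem). [folklore] -/
theorem neZero_card [Finite Γ] {q : ℕ} [Fact q.Prime] (hq : ¬ q ∣ Nat.card Γ) :
    NeZero ((Nat.card Γ : ℕ) : ZMod q) :=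
  ⟨fun h => hq ((ZMod.natCast_eq_zero_iff _ _).mp h)⟩

/-- **`ℤ[Γ]/(q) ≅ 𝔽_q[Γ]` is reduced for a prime `q ∤ #Γ`** (Maschke's theorem: `𝔽_q[Γ]` is
semisimple [Schoof2009, Proposition 13.1, p. 85 "The group ring `k[Γ]` is semisimple"]; a
commutative semisimple ring has no nilpotents). [cite: Schoof2009, Proposition 13.1] -/
theorem isReduced_quotient_span [Finite Γ] {q : ℕ} [Fact q.Prime] (hq : ¬ q ∣ Nat.card Γ) :
    IsReduced (MonoidAlgebra ℤ Γ ⧸ Ideal.span {(q : MonoidAlgebra ℤ Γ)}) := by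
  haveI := neZero_card (Γ := Γ) hq
  haveI : IsReduced (MonoidAlgebra (ZMod q) Γ) := inferInstance
  have e : (MonoidAlgebra ℤ Γ ⧸ Ideal.span {(q : MonoidAlgebra ℤ Γ)}) ≃+*
      MonoidAlgebra (ZMod q) Γ :=
    (Ideal.quotEquivOfEq (ker_mapRingHom_intCast (Γ := Γ) q).symm).trans
      (RingHom.quotientKerEquivOfSurjective (mapRingHom_intCast_surjective (Γ := Γ) q))
  exact _root_.isReduced_of_injective e.toRingHom e.injective

/-- The same, as a ring isomorphism statement: `ℤ[Γ]/(q) ≅ (ℤ/q)[Γ]`. [folklore] -/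
theorem nonempty_quotient_span_ringEquiv (q : ℕ) :
    Nonempty ((MonoidAlgebra ℤ Γ ⧸ Ideal.span {(q : MonoidAlgebra ℤ Γ)}) ≃+*
      MonoidAlgebra (ZMod q) Γ) :=
  ⟨(Ideal.quotEquivOfEq (ker_mapRingHom_intCast (Γ := Γ) q).symm).trans
      (RingHom.quotientKerEquivOfSurjective (mapRingHom_intCast_surjective (Γ := Γ) q))⟩

end Catalan.Semisimple

end Literature.NumberTheory.DiophantineGeometry
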